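import Summits.QuantumFields.BalabanUV.Beta.SymCorrectorSlot
import Summits.QuantumFields.BalabanUV.Beta.SymCorrectorFaceDiv
import Summits.QuantumFields.BalabanUV.Beta.KernelWardResidual

/-!
# `BalabanUV.Beta.GAN24.PsiLegDefectOfDivergences` — binder row G-an2-4 ∕ (CONV-C), W-slot, TRANSFER-III: **THE Ψ-DEFECT ON THE TWO KERNEL LEGS OF A BI-TABLE IS `LocStencil₂`
# BY THE LEG-DIVERGENCE LETTER ROWS** — the leg twin of `GAN24/PsiSlotDefectOfDivergences` (road-P2 g55 W-3 l.65196: «the same defect calculus applies to the two KERNEL legs of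
# `Ψ̂ᵀ ∘ (slotPsiS X) ∘ Ψ̂` (each a `slotPsiS` on a bond leg), fed by the (Q-L) leg-letter rows `hL₁ ∕ hL₂` … if you want that twin typed, it is yours first»).

NOT IN PRINT; OUR BOOKKEEPING (G-an2-4 crux team (2), leaf prover `b2b-balaban-gan24-formalise-leaf-03`, gen 79).  [folklore] finite-sum bookkeeping BY NAME over d1-formalise-leaf-03's
`SymCorrectorSlot.comp_trK_psiKS_inl_left ∕ comp_trK_psiKS_inr_left ∕ comp_psiKS_inl_right ∕ comp_psiKS_inr_right` (the field legs of ANY kernel transport by the scalar `slotPsiS`, the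
multiplier legs are untouched — road-P2 g55's M.46 `CombTransportThreeLegs.conj_inl_inl` is the packaged identity, its sibling) and `SymCorrectorFaceDiv.faceSum_eq_blockSum_div` (the face
sum is the block sum of the leg divergence); 0 `def`, 0 cited facts, 0 `def … : Prop`, 0 sorry.  The leg-letter binders are MY g66 `HalfMemberCellOfDivergences.cell_rows_of_divergence_rows`
binders `hL₁` (first kernel leg) ∕ `hL₂` (second kernel leg) VERBATIM.
HONEST FRAMING (cell contract, verbatim): «discharging `BetaPertH` makes Bałaban's UV stability UNCONDITIONAL — a real constructive-QFT result; it is NOT the continuum limit and NOT the Clay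
problem.»  HONEST DEPENDENCY (verbatim): «continuum YM on T⁴ ⇐ BetaPertH ∧ nine spine estimates (0/9 proved); BetaPertH ⇐ (D1) ∧ (D4) ∧ CAP+tail; G-an2-4 gates asym, D1 and NE2/3/4.»

CONTENTS (generic `d`; `0 < n`; root `r ∈ box (d+1) n`; `0 ≤ δ`; `Ψ̂ := psiKS r n`; `B(Y) := blockSitesF n Y`):
* §1 `abs_blockSum_le_of_anchored`; **`locStencil₂_legLeft_sub_self_of_divergence_row`**: `hL₁ ⟹ LocStencil₂ (κ u κ′ u′ ↦ Ψ̂ᵀ ∘ Z κ u κ′ u′ − Z κ u κ′ u′) (faceWtSum · (n^{d+1} · (e^{δ(d+1)n} · C_{L1}))) δ`;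
  **`locStencil₂_legRight_sub_self_of_divergence_row`**: `hL₂ ⟹ LocStencil₂ (κ u κ′ u′ ↦ Z κ u κ′ u′ ∘ Ψ̂ − Z κ u κ′ u′) (faceWtSum · (n^{d+1} · (e^{δ(d+1)n} · C_{L2}))) δ`.
* §2 `abs_faceSum_le_of_anchored` (scalar face sums of anchored families), `slotPsiS_sum_sub` (pointwise linearity), **`locStencil₂_legLeftRow_compRight_of_divergence_row`** (the first-leg
  letter row SURVIVES the right transport: constant `C_{L1}·(1 + faceWtSum·(d+1)·2n^{d+1}·e^{δ(d+1)n})`), **`locStencil₂_legConj_sub_self_of_divergence_rows`**: `hL₁ ∧ hL₂ ⟹ LocStencil₂ (κ u κ′ u′ ↦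
  Ψ̂ᵀ ∘ (Z κ u κ′ u′ ∘ Ψ̂) − Z κ u κ′ u′) (…) δ` — THE TWO-LEG DEFECT from the two leg letters.
READING (zero weight): with the two SLOT defects (`PsiSlotDefectOfDivergences` §1–§3) these are the four one-variable Ψ-defects of the (III′) cell's table transport (sizing note v0.5 §8):
all FOUR are fed by the (α-0) chain's existing letter rows.  WHAT THIS IS NOT: NOT the composite four-variable (slots + legs) defect — (C-6)'s first lemma —, NOT the cell rows (C-6), NOT a letter at the comb data, NOT a value;
the (III′) campaign is NOT asked (an2 W-4) — a zero-weight composition typed while idle; NEVER «G-an2-4 closed» as (CONV-C); NOT D1, NOT `BetaPertH`, NOT continuum, NOT Clay.  2026-08-25.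
-/

noncomputable section

open Finset
open scoped BigOperators
open Literature.MathematicalPhysics.QuantumFieldTheory
open Literature.MathematicalPhysics.QuantumFieldTheory.Balaban1983to89
open Literature.MathematicalPhysics.QuantumFieldTheory.Balaban1983to89.Beta
open B12Sec2to5 (l1 l1_nonneg)
open ExpKernelCalculus (MKer Site BiLoc comp l1_sub_triangle l1_sub_symm)
open OneStepResolventKernel (Fib)
open AffineAveraging (box unitVec)
open AveragingContours (blk)
open BalabanCompositeJets (LocStencil₂)
open AxialDressing (l1_sub_le_of_blk_eq)
open Summit.QuantumFields.BalabanUV.Beta.TameKernelCalculus (trK)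
open Summit.QuantumFields.BalabanUV.Beta.CompositeCorrectorLocality (blockSitesF)
open Summit.QuantumFields.BalabanUV.Beta.SymCorrectorKernel (psiKS)
open Summit.QuantumFields.BalabanUV.Beta.KernelWardRelative (gaugeWt)
open Summit.QuantumFields.BalabanUV.Beta.KernelWardResidual (abs_gaugeWt_le_one)
open Summit.QuantumFields.BalabanUV.Beta.SymCorrectorFace (faceWt faceSum slotPsiS faceWtSum faceWtSum_nonneg abs_faceWt_le card_blockSitesF bondNbhd card_bondNbhd_le
  l1_le_of_mem_bondNbhd)
open BalabanStepW2 (locStencil₂_add')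
open Summit.QuantumFields.BalabanUV.Beta.SymCorrectorFaceDiv (faceSum_eq_blockSum_div blk_eq_of_mem_blockSitesF)
open Summit.QuantumFields.BalabanUV.Beta.SymCorrectorSlot (comp_trK_psiKS_inl_left comp_trK_psiKS_inr_left comp_psiKS_inl_right comp_psiKS_inr_right)

namespace Summit.QuantumFields.BalabanUV.Beta.GAN24.PsiLegDefectOfDivergences

variable {d : ℕ} {n : ℕ} (hn : 0 < n) {r : Fin (d + 1) → ℕ} (hr : r ∈ box (d + 1) n)

omit hn in
/-- [folklore] A block sum of reals each bounded by `C·e^{−δ·l1(x' − u)}`-type weights re-anchored at the block's reference site: if `|f x'| ≤ C · e^{−δ (l1 (x' − u) + E)}` for all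
`x' ∈ B(blk n x)` (`0 ≤ C`, `0 ≤ δ`), then `|Σ_{x' ∈ B(blk n x)} f x'| ≤ n^{d+1} · e^{δ(d+1)n} · C · e^{−δ (l1 (x − u) + E)}`. -/
theorem abs_blockSum_le_of_anchored (hn1 : 1 ≤ n) {f : Site (d + 1) → ℝ} {x u : Site (d + 1)} {C δ E : ℝ} (hC : 0 ≤ C) (hδ : 0 ≤ δ)
    (hf : ∀ x' ∈ blockSitesF n (blk n x), |f x'| ≤ C * Real.exp (-δ * (l1 (x' - u) + E))) :
    |∑ x' ∈ blockSitesF n (blk n x), f x'| ≤ ((n : ℝ) ^ (d + 1)) * (Real.exp (δ * (((d : ℝ) + 1) * n)) * C) * Real.exp (-δ * (l1 (x - u) + E)) := by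
  have hx : ∀ x' ∈ blockSitesF n (blk n x), |f x'| ≤ Real.exp (δ * (((d : ℝ) + 1) * n)) * C * Real.exp (-δ * (l1 (x - u) + E)) := by
    intro x' hx'
    have hb : blk n x' = blk n x := blk_eq_of_mem_blockSitesF (lt_of_lt_of_le Nat.zero_lt_one hn1) hx'
    have h1 : l1 (x - x') ≤ ((d : ℝ) + 1) * n := l1_sub_le_of_blk_eq hn1 hb
    have h2 : l1 (x - u) ≤ l1 (x - x') + l1 (x' - u) := l1_sub_triangle x x' u
    refine (hf x' hx').trans ?_
    calc C * Real.exp (-δ * (l1 (x' - u) + E)) ≤ C * Real.exp (δ * (((d : ℝ) + 1) * n) + -δ * (l1 (x - u) + E)) :=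
          mul_le_mul_of_nonneg_left (Real.exp_le_exp.mpr (by nlinarith)) hC
      _ = Real.exp (δ * (((d : ℝ) + 1) * n)) * C * Real.exp (-δ * (l1 (x - u) + E)) := by rw [Real.exp_add]; ring
  calc |∑ x' ∈ blockSitesF n (blk n x), f x'| ≤ ∑ x' ∈ blockSitesF n (blk n x), |f x'| := Finset.abs_sum_le_sum_abs _ _
    _ ≤ ∑ _x' ∈ blockSitesF n (blk n x), Real.exp (δ * (((d : ℝ) + 1) * n)) * C * Real.exp (-δ * (l1 (x - u) + E)) := Finset.sum_le_sum hx
    _ = ((n : ℝ) ^ (d + 1)) * (Real.exp (δ * (((d : ℝ) + 1) * n)) * C) * Real.exp (-δ * (l1 (x - u) + E)) := by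
        rw [Finset.sum_const, card_blockSitesF, nsmul_eq_mul]; push_cast; ring

include hn hr

/-- [folklore] **THE LEFT-LEG Ψ-DEFECT OF A BI-TABLE IS `LocStencil₂` BY THE FIRST-LEG DIVERGENCE LETTER** (any `Z`, `0 ≤ δ`): from MY g66 binder
`hL₁ : LocStencil₂ (κ u κ′ u′ ↦ (p z _ b ↦ Σ_β (Z κ u κ′ u′ p z (inl β) b − Z κ u κ′ u′ (p − e_β) z (inl β) b))) C_{L1} δ`:
`LocStencil₂ (κ u κ′ u′ ↦ Ψ̂ᵀ ∘ Z κ u κ′ u′ − Z κ u κ′ u′) (faceWtSum r n · (n^{d+1} · (e^{δ(d+1)n} · C_{L1}))) δ` — on a field leg `Ψ̂ᵀ ∘ Y − Y = faceWt ·` the block sum of the left-leg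
divergence (`comp_trK_psiKS_inl_left`, `faceSum_eq_blockSum_div`), on a multiplier leg it vanishes (`comp_trK_psiKS_inr_left`). -/
theorem locStencil₂_legLeft_sub_self_of_divergence_row
    (Z : Fin (d + 1) → Site (d + 1) → Fin (d + 1) → Site (d + 1) → MKer (d + 1) (Fib d)) {CL₁ δ : ℝ} (hδ : 0 ≤ δ)
    (hL₁ : LocStencil₂ (fun κ u κ' u' => fun (p z : Site (d + 1)) (_ : Fib d) (b : Fib d) =>
      ∑ β : Fin (d + 1), (Z κ u κ' u' p z (Sum.inl β) b - Z κ u κ' u' (p - unitVec β) z (Sum.inl β) b)) CL₁ δ) :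
    LocStencil₂ (fun κ u κ' u' => comp (trK (psiKS r n)) (Z κ u κ' u') - Z κ u κ' u')
      (faceWtSum r n * (((n : ℝ) ^ (d + 1)) * (Real.exp (δ * (((d : ℝ) + 1) * n)) * CL₁))) δ := by
  have hn1 : 1 ≤ n := hn
  have hCL : 0 ≤ CL₁ := hL₁.nonneg
  intro κ u κ' u' x w a b
  have hpos : 0 ≤ faceWtSum r n * (((n : ℝ) ^ (d + 1)) * (Real.exp (δ * (((d : ℝ) + 1) * n)) * CL₁)) * Real.exp (-δ * l1 (u' - u))
      * Real.exp (-δ * (l1 (x - u) + l1 (w - u))) := by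
    have := faceWtSum_nonneg r n; positivity
  rcases a with β | m
  · -- field leg: the defect is `faceWt β x ·` the face sum of the left legs = block sum of the left-leg divergence
    change |(comp (trK (psiKS r n)) (Z κ u κ' u') - Z κ u κ' u') x w (Sum.inl β) b| ≤ _
    simp only [Pi.sub_apply]
    rw [comp_trK_psiKS_inl_left hn hr, slotPsiS, add_sub_cancel_left, smul_eq_mul, faceSum_eq_blockSum_div hn]
    -- each block term is (minus) the letter kernel's entry at `(x', w, ·, b)`
    have hf : ∀ x' ∈ blockSitesF n (blk n x), |∑ κ₁ : Fin (d + 1), (Z κ u κ' u' (x' - unitVec κ₁) w (Sum.inl κ₁) b - Z κ u κ' u' x' w (Sum.inl κ₁) b)|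
        ≤ CL₁ * Real.exp (-δ * l1 (u' - u)) * Real.exp (-δ * (l1 (x' - u) + l1 (w - u))) := by
      intro x' _
      have h := hL₁ κ u κ' u' x' w (Sum.inl β) b
      rw [← abs_neg]
      refine (le_of_eq ?_).trans h
      congr 1
      simp only [Finset.sum_sub_distrib]
      ring
    have hf' : ∀ x' ∈ blockSitesF n (blk n x), |∑ κ₁ : Fin (d + 1), (Z κ u κ' u' (x' - unitVec κ₁) w (Sum.inl κ₁) b - Z κ u κ' u' x' w (Sum.inl κ₁) b)|
        ≤ (CL₁ * Real.exp (-δ * l1 (u' - u))) * Real.exp (-δ * (l1 (x' - u) + l1 (w - u))) := fun x' hx' => hf x' hx'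
    have hsum := abs_blockSum_le_of_anchored (x := x) (u := u) (E := l1 (w - u)) hn1 (by positivity) hδ hf'
    have hw : |faceWt r n β x| ≤ faceWtSum r n := abs_faceWt_le hn r β x
    rw [abs_mul]
    calc |faceWt r n β x| * |∑ x' ∈ blockSitesF n (blk n x), ∑ κ₁ : Fin (d + 1), (Z κ u κ' u' (x' - unitVec κ₁) w (Sum.inl κ₁) b - Z κ u κ' u' x' w (Sum.inl κ₁) b)|
          ≤ faceWtSum r n * (((n : ℝ) ^ (d + 1)) * (Real.exp (δ * (((d : ℝ) + 1) * n)) * (CL₁ * Real.exp (-δ * l1 (u' - u)))) * Real.exp (-δ * (l1 (x - u) + l1 (w - u)))) :=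
          mul_le_mul hw hsum (abs_nonneg _) (faceWtSum_nonneg r n)
      _ = faceWtSum r n * (((n : ℝ) ^ (d + 1)) * (Real.exp (δ * (((d : ℝ) + 1) * n)) * CL₁)) * Real.exp (-δ * l1 (u' - u))
          * Real.exp (-δ * (l1 (x - u) + l1 (w - u))) := by ring
  · -- multiplier leg: untouched
    change |(comp (trK (psiKS r n)) (Z κ u κ' u') - Z κ u κ' u') x w (Sum.inr m) b| ≤ _
    simp only [Pi.sub_apply]
    rw [comp_trK_psiKS_inr_left, sub_self, abs_zero]
    exact hpos

/-- [folklore] **THE RIGHT-LEG Ψ-DEFECT OF A BI-TABLE IS `LocStencil₂` BY THE SECOND-LEG DIVERGENCE LETTER** (any `Z`, `0 ≤ δ`): from MY g66 binder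
`hL₂ : LocStencil₂ (κ u κ′ u′ ↦ (x p a _ ↦ Σ_β (Z κ u κ′ u′ x p a (inl β) − Z κ u κ′ u′ x (p − e_β) a (inl β)))) C_{L2} δ`:
`LocStencil₂ (κ u κ′ u′ ↦ Z κ u κ′ u′ ∘ Ψ̂ − Z κ u κ′ u′) (faceWtSum r n · (n^{d+1} · (e^{δ(d+1)n} · C_{L2}))) δ` (`comp_psiKS_inl_right`, `comp_psiKS_inr_right`). -/
theorem locStencil₂_legRight_sub_self_of_divergence_row
    (Z : Fin (d + 1) → Site (d + 1) → Fin (d + 1) → Site (d + 1) → MKer (d + 1) (Fib d)) {CL₂ δ : ℝ} (hδ : 0 ≤ δ)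
    (hL₂ : LocStencil₂ (fun κ u κ' u' => fun (x p : Site (d + 1)) (a : Fib d) (_ : Fib d) =>
      ∑ β : Fin (d + 1), (Z κ u κ' u' x p a (Sum.inl β) - Z κ u κ' u' x (p - unitVec β) a (Sum.inl β))) CL₂ δ) :
    LocStencil₂ (fun κ u κ' u' => comp (Z κ u κ' u') (psiKS r n) - Z κ u κ' u')
      (faceWtSum r n * (((n : ℝ) ^ (d + 1)) * (Real.exp (δ * (((d : ℝ) + 1) * n)) * CL₂))) δ := by
  have hn1 : 1 ≤ n := hn
  have hCL : 0 ≤ CL₂ := hL₂.nonneg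
  intro κ u κ' u' x w a b
  have hpos : 0 ≤ faceWtSum r n * (((n : ℝ) ^ (d + 1)) * (Real.exp (δ * (((d : ℝ) + 1) * n)) * CL₂)) * Real.exp (-δ * l1 (u' - u))
      * Real.exp (-δ * (l1 (x - u) + l1 (w - u))) := by
    have := faceWtSum_nonneg r n; positivity
  rcases b with β | m
  · change |(comp (Z κ u κ' u') (psiKS r n) - Z κ u κ' u') x w a (Sum.inl β)| ≤ _
    simp only [Pi.sub_apply]
    rw [comp_psiKS_inl_right hn hr, slotPsiS, add_sub_cancel_left, smul_eq_mul, faceSum_eq_blockSum_div hn]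
    have hf' : ∀ w' ∈ blockSitesF n (blk n w), |∑ κ₁ : Fin (d + 1), (Z κ u κ' u' x (w' - unitVec κ₁) a (Sum.inl κ₁) - Z κ u κ' u' x w' a (Sum.inl κ₁))|
        ≤ (CL₂ * Real.exp (-δ * l1 (u' - u))) * Real.exp (-δ * (l1 (w' - u) + l1 (x - u))) := by
      intro w' _
      have h := hL₂ κ u κ' u' x w' a (Sum.inl β)
      rw [← abs_neg, add_comm (l1 (w' - u))]
      refine (le_of_eq ?_).trans h
      congr 1
      simp only [Finset.sum_sub_distrib]
      ring
    have hsum := abs_blockSum_le_of_anchored (x := w) (u := u) (E := l1 (x - u)) hn1 (by positivity) hδ hf'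
    have hw : |faceWt r n β w| ≤ faceWtSum r n := abs_faceWt_le hn r β w
    rw [abs_mul]
    calc |faceWt r n β w| * |∑ w' ∈ blockSitesF n (blk n w), ∑ κ₁ : Fin (d + 1), (Z κ u κ' u' x (w' - unitVec κ₁) a (Sum.inl κ₁) - Z κ u κ' u' x w' a (Sum.inl κ₁))|
          ≤ faceWtSum r n * (((n : ℝ) ^ (d + 1)) * (Real.exp (δ * (((d : ℝ) + 1) * n)) * (CL₂ * Real.exp (-δ * l1 (u' - u)))) * Real.exp (-δ * (l1 (w - u) + l1 (x - u)))) :=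
          mul_le_mul hw hsum (abs_nonneg _) (faceWtSum_nonneg r n)
      _ = faceWtSum r n * (((n : ℝ) ^ (d + 1)) * (Real.exp (δ * (((d : ℝ) + 1) * n)) * CL₂)) * Real.exp (-δ * l1 (u' - u))
          * Real.exp (-δ * (l1 (x - u) + l1 (w - u))) := by rw [add_comm (l1 (w - u))]; ring
  · change |(comp (Z κ u κ' u') (psiKS r n) - Z κ u κ' u') x w a (Sum.inr m)| ≤ _
    simp only [Pi.sub_apply]
    rw [comp_psiKS_inr_right, sub_self, abs_zero]
    exact hpos

/-! ## §2 The composite leg conjugation `Ψ̂ᵀ ∘ Y ∘ Ψ̂`: the left-leg letter survives the right transport; the two-leg defect -/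

omit hn hr in
/-- [folklore] **A SCALAR FACE SUM OF AN ANCHORED FAMILY**: if `|T κ u| ≤ C·e^{−δ(A + l1(u − u₀))}` on the face neighbourhood of the block of `w` (`0 ≤ C`, `0 ≤ δ`), then
`|faceSum n T (blk n w)| ≤ (d+1)·(2n^{d+1})·e^{δ(d+1)n}·C·e^{−δ(A + l1(w − u₀))}` (`|gaugeWt| ≤ 1`, `card_bondNbhd_le`, `l1_le_of_mem_bondNbhd`). -/
theorem abs_faceSum_le_of_anchored (hn : 0 < n) {T : Fin (d + 1) → Site (d + 1) → ℝ} {w u₀ : Site (d + 1)} {C δ A : ℝ} (hC : 0 ≤ C) (hδ : 0 ≤ δ)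
    (hT : ∀ (κ : Fin (d + 1)), ∀ u ∈ bondNbhd n (blk n w) κ, |T κ u| ≤ C * Real.exp (-δ * (A + l1 (u - u₀)))) :
    |faceSum n T (blk n w)| ≤ ((d : ℝ) + 1) * ((2 * (n : ℝ) ^ (d + 1)) * (Real.exp (δ * (((d : ℝ) + 1) * n)) * C)) * Real.exp (-δ * (A + l1 (w - u₀))) := by
  set c : ℝ := Real.exp (δ * (((d : ℝ) + 1) * n)) * C * Real.exp (-δ * (A + l1 (w - u₀))) with hc
  have hc0 : 0 ≤ c := by rw [hc]; positivity
  have hterm : ∀ (κ : Fin (d + 1)), ∀ u ∈ bondNbhd n (blk n w) κ, |gaugeWt n (blk n w) κ u • T κ u| ≤ c := by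
    intro κ u hu
    have h1 : l1 (u - w) ≤ ((d + 1 : ℕ) : ℝ) * n := l1_le_of_mem_bondNbhd hn hu
    push_cast at h1
    have h2 : l1 (w - u₀) ≤ l1 (w - u) + l1 (u - u₀) := l1_sub_triangle w u u₀
    rw [l1_sub_symm w u] at h2
    rw [smul_eq_mul, abs_mul]
    have hg : |gaugeWt n (blk n w) κ u| ≤ 1 := abs_gaugeWt_le_one n (blk n w) κ u
    calc |gaugeWt n (blk n w) κ u| * |T κ u| ≤ 1 * (C * Real.exp (-δ * (A + l1 (u - u₀)))) :=
          mul_le_mul hg (hT κ u hu) (abs_nonneg _) zero_le_one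
      _ = C * Real.exp (-δ * (A + l1 (u - u₀))) := one_mul _
      _ ≤ C * Real.exp (δ * (((d : ℝ) + 1) * n) + -δ * (A + l1 (w - u₀))) := mul_le_mul_of_nonneg_left (Real.exp_le_exp.mpr (by nlinarith)) hC
      _ = c := by rw [hc, Real.exp_add]; ring
  rw [faceSum]
  calc |∑ κ : Fin (d + 1), ∑ u ∈ bondNbhd n (blk n w) κ, gaugeWt n (blk n w) κ u • T κ u|
        ≤ ∑ κ : Fin (d + 1), |∑ u ∈ bondNbhd n (blk n w) κ, gaugeWt n (blk n w) κ u • T κ u| := Finset.abs_sum_le_sum_abs _ _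
    _ ≤ ∑ κ : Fin (d + 1), ∑ u ∈ bondNbhd n (blk n w) κ, |gaugeWt n (blk n w) κ u • T κ u| :=
        Finset.sum_le_sum fun κ _ => Finset.abs_sum_le_sum_abs _ _
    _ ≤ ∑ κ : Fin (d + 1), ∑ _u ∈ bondNbhd n (blk n w) κ, c := Finset.sum_le_sum fun κ _ => Finset.sum_le_sum fun u hu => hterm κ u hu
    _ ≤ ∑ _κ : Fin (d + 1), (2 * (n : ℝ) ^ (d + 1)) * c := Finset.sum_le_sum fun κ _ => by
        rw [Finset.sum_const, nsmul_eq_mul]; exact mul_le_mul_of_nonneg_right (card_bondNbhd_le n (blk n w) κ) hc0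
    _ = ((d : ℝ) + 1) * ((2 * (n : ℝ) ^ (d + 1)) * (Real.exp (δ * (((d : ℝ) + 1) * n)) * C)) * Real.exp (-δ * (A + l1 (w - u₀))) := by
        rw [Finset.sum_const, Finset.card_univ, Fintype.card_fin, nsmul_eq_mul, hc]; push_cast; ring

omit hn hr in
/-- [folklore] The scalar slot transport commutes with finite sums of differences of families (pointwise linearity of `slotPsiS`). -/
theorem slotPsiS_sum_sub (s : Finset (Fin (d + 1))) (F G : Fin (d + 1) → Fin (d + 1) → Site (d + 1) → ℝ) (β : Fin (d + 1)) (w : Site (d + 1)) :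
    ∑ i ∈ s, (slotPsiS r n (F i) β w - slotPsiS r n (G i) β w) = slotPsiS r n (fun κ u => ∑ i ∈ s, (F i κ u - G i κ u)) β w := by
  let φ : (Fin (d + 1) → Site (d + 1) → ℝ) →+ ℝ :=
    { toFun := fun T => slotPsiS r n T β w
      map_zero' := by
        simp only [slotPsiS, faceSum, Pi.zero_apply, smul_zero, Finset.sum_const_zero, add_zero]
      map_add' := fun T T' => by
        simp only [slotPsiS, faceSum, Pi.add_apply, smul_add, Finset.sum_add_distrib]
        ring }
  have h : ∀ i, slotPsiS r n (F i) β w - slotPsiS r n (G i) β w = φ (F i - G i) := fun i => (map_sub φ (F i) (G i)).symm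
  simp_rw [h]
  rw [← map_sum φ]
  show slotPsiS r n (∑ i ∈ s, (F i - G i)) β w = _
  congr 1
  funext κ u
  simp only [Finset.sum_apply, Pi.sub_apply]

/-- [folklore] **THE FIRST-LEG LETTER ROW SURVIVES THE RIGHT TRANSPORT** (any `Z`, `0 ≤ δ`): from `hL₁` (constant `C_{L1}`), the first-leg letter row of the right-transported table
`κ u κ′ u′ ↦ Z κ u κ′ u′ ∘ Ψ̂` holds with constant `C_{L1} · (1 + faceWtSum·((d+1)·(2n^{d+1})·e^{δ(d+1)n}))` — on a field right leg the letter kernel is `slotPsiS`-transported in its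
right variable (`comp_psiKS_inl_right` + linearity), on a multiplier right leg it is unchanged. -/
theorem locStencil₂_legLeftRow_compRight_of_divergence_row
    (Z : Fin (d + 1) → Site (d + 1) → Fin (d + 1) → Site (d + 1) → MKer (d + 1) (Fib d)) {CL₁ δ : ℝ} (hδ : 0 ≤ δ)
    (hL₁ : LocStencil₂ (fun κ u κ' u' => fun (p z : Site (d + 1)) (_ : Fib d) (b : Fib d) =>
      ∑ β : Fin (d + 1), (Z κ u κ' u' p z (Sum.inl β) b - Z κ u κ' u' (p - unitVec β) z (Sum.inl β) b)) CL₁ δ) :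
    LocStencil₂ (fun κ u κ' u' => fun (p z : Site (d + 1)) (_ : Fib d) (b : Fib d) =>
      ∑ β : Fin (d + 1), (comp (Z κ u κ' u') (psiKS r n) p z (Sum.inl β) b - comp (Z κ u κ' u') (psiKS r n) (p - unitVec β) z (Sum.inl β) b))
      (CL₁ * (1 + faceWtSum r n * (((d : ℝ) + 1) * ((2 * (n : ℝ) ^ (d + 1)) * Real.exp (δ * (((d : ℝ) + 1) * n)))))) δ := by
  have hCL : 0 ≤ CL₁ := hL₁.nonneg
  intro κ u κ' u' p w a b
  have hF : 0 ≤ faceWtSum r n * (((d : ℝ) + 1) * ((2 * (n : ℝ) ^ (d + 1)) * Real.exp (δ * (((d : ℝ) + 1) * n)))) := by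
    have := faceWtSum_nonneg r n; positivity
  rcases b with β' | m
  · -- field right leg: the letter kernel is right-transported
    have e : (∑ β : Fin (d + 1), (comp (Z κ u κ' u') (psiKS r n) p w (Sum.inl β) (Sum.inl β')
          - comp (Z κ u κ' u') (psiKS r n) (p - unitVec β) w (Sum.inl β) (Sum.inl β')))
        = slotPsiS r n (fun κ₁ u₁ => ∑ β : Fin (d + 1), (Z κ u κ' u' p u₁ (Sum.inl β) (Sum.inl κ₁) - Z κ u κ' u' (p - unitVec β) u₁ (Sum.inl β) (Sum.inl κ₁))) β' w := by
      simp only [comp_psiKS_inl_right hn hr]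
      exact slotPsiS_sum_sub Finset.univ _ _ β' w
    change |(∑ β : Fin (d + 1), (comp (Z κ u κ' u') (psiKS r n) p w (Sum.inl β) (Sum.inl β')
        - comp (Z κ u κ' u') (psiKS r n) (p - unitVec β) w (Sum.inl β) (Sum.inl β')))| ≤ _
    rw [e, slotPsiS, smul_eq_mul]
    -- the raw letter entry and the face sum of the letter's right legs
    have h0 := hL₁ κ u κ' u' p w a (Sum.inl β')
    have hT : ∀ (κ₁ : Fin (d + 1)), ∀ u₁ ∈ bondNbhd n (blk n w) κ₁,
        |∑ β : Fin (d + 1), (Z κ u κ' u' p u₁ (Sum.inl β) (Sum.inl κ₁) - Z κ u κ' u' (p - unitVec β) u₁ (Sum.inl β) (Sum.inl κ₁))|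
          ≤ (CL₁ * Real.exp (-δ * l1 (u' - u))) * Real.exp (-δ * (l1 (p - u) + l1 (u₁ - u))) := fun κ₁ u₁ _ => hL₁ κ u κ' u' p u₁ a (Sum.inl κ₁)
    have hfs := abs_faceSum_le_of_anchored hn (w := w) (u₀ := u) (A := l1 (p - u)) (by positivity) hδ hT
    have hw : |faceWt r n β' w| ≤ faceWtSum r n := abs_faceWt_le hn r β' w
    calc |(∑ β : Fin (d + 1), (Z κ u κ' u' p w (Sum.inl β) (Sum.inl β') - Z κ u κ' u' (p - unitVec β) w (Sum.inl β) (Sum.inl β')))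
            + faceWt r n β' w * faceSum n (fun κ₁ u₁ => ∑ β : Fin (d + 1), (Z κ u κ' u' p u₁ (Sum.inl β) (Sum.inl κ₁)
              - Z κ u κ' u' (p - unitVec β) u₁ (Sum.inl β) (Sum.inl κ₁))) (blk n w)|
          ≤ |∑ β : Fin (d + 1), (Z κ u κ' u' p w (Sum.inl β) (Sum.inl β') - Z κ u κ' u' (p - unitVec β) w (Sum.inl β) (Sum.inl β'))|
            + |faceWt r n β' w| * |faceSum n (fun κ₁ u₁ => ∑ β : Fin (d + 1), (Z κ u κ' u' p u₁ (Sum.inl β) (Sum.inl κ₁)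
              - Z κ u κ' u' (p - unitVec β) u₁ (Sum.inl β) (Sum.inl κ₁))) (blk n w)| := by
          rw [← abs_mul]; exact abs_add_le _ _
      _ ≤ CL₁ * Real.exp (-δ * l1 (u' - u)) * Real.exp (-δ * (l1 (p - u) + l1 (w - u)))
            + faceWtSum r n * (((d : ℝ) + 1) * ((2 * (n : ℝ) ^ (d + 1)) * (Real.exp (δ * (((d : ℝ) + 1) * n)) * (CL₁ * Real.exp (-δ * l1 (u' - u)))))
              * Real.exp (-δ * (l1 (p - u) + l1 (w - u)))) :=
          add_le_add h0 (mul_le_mul hw hfs (abs_nonneg _) (faceWtSum_nonneg r n))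
      _ = CL₁ * (1 + faceWtSum r n * (((d : ℝ) + 1) * ((2 * (n : ℝ) ^ (d + 1)) * Real.exp (δ * (((d : ℝ) + 1) * n)))))
            * Real.exp (-δ * l1 (u' - u)) * Real.exp (-δ * (l1 (p - u) + l1 (w - u))) := by ring
  · -- multiplier right leg: unchanged letter
    change |(∑ β : Fin (d + 1), (comp (Z κ u κ' u') (psiKS r n) p w (Sum.inl β) (Sum.inr m)
        - comp (Z κ u κ' u') (psiKS r n) (p - unitVec β) w (Sum.inl β) (Sum.inr m)))| ≤ _
    simp only [comp_psiKS_inr_right]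
    refine (hL₁ κ u κ' u' p w a (Sum.inr m)).trans ?_
    have hE : 0 ≤ Real.exp (-δ * l1 (u' - u)) * Real.exp (-δ * (l1 (p - u) + l1 (w - u))) := by positivity
    calc CL₁ * Real.exp (-δ * l1 (u' - u)) * Real.exp (-δ * (l1 (p - u) + l1 (w - u)))
          = CL₁ * 1 * (Real.exp (-δ * l1 (u' - u)) * Real.exp (-δ * (l1 (p - u) + l1 (w - u)))) := by ring
      _ ≤ CL₁ * (1 + faceWtSum r n * (((d : ℝ) + 1) * ((2 * (n : ℝ) ^ (d + 1)) * Real.exp (δ * (((d : ℝ) + 1) * n)))))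
            * (Real.exp (-δ * l1 (u' - u)) * Real.exp (-δ * (l1 (p - u) + l1 (w - u)))) :=
          mul_le_mul_of_nonneg_right (mul_le_mul_of_nonneg_left (le_add_of_nonneg_right hF) hCL) hE
      _ = CL₁ * (1 + faceWtSum r n * (((d : ℝ) + 1) * ((2 * (n : ℝ) ^ (d + 1)) * Real.exp (δ * (((d : ℝ) + 1) * n)))))
            * Real.exp (-δ * l1 (u' - u)) * Real.exp (-δ * (l1 (p - u) + l1 (w - u))) := by ring

/-- [folklore] **THE TWO-LEG Ψ-DEFECT `Ψ̂ᵀ ∘ Y ∘ Ψ̂ − Y` OF A BI-TABLE IS `LocStencil₂` BY THE TWO LEG LETTERS** (any `Z`, `0 ≤ δ`): from `hL₁ ∧ hL₂`,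
`LocStencil₂ (κ u κ′ u′ ↦ Ψ̂ᵀ ∘ Z κ u κ′ u′ ∘ Ψ̂ − Z κ u κ′ u′) (faceWtSum·n^{d+1}·e^{δ(d+1)n}·(C_{L1}·(1 + faceWtSum·(d+1)·2n^{d+1}·e^{δ(d+1)n}) + C_{L2})) δ`
— §1 (left) on the right-transported table with §2's transported `hL₁`, plus §1 (right) on `Z` (`Ψ̂ᵀ(YΨ̂) − Y = (Ψ̂ᵀ(YΨ̂) − YΨ̂) + (YΨ̂ − Y)`; bracketing `Ψ̂ᵀ ∘ (Y ∘ Ψ̂)` —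
road-P2's `(Ψ̂ᵀ ∘ Y) ∘ Ψ̂` agrees with it for tame `Y` by `TameKernelCalculus.comp_assoc_tame`). -/
theorem locStencil₂_legConj_sub_self_of_divergence_rows
    (Z : Fin (d + 1) → Site (d + 1) → Fin (d + 1) → Site (d + 1) → MKer (d + 1) (Fib d)) {CL₁ CL₂ δ : ℝ} (hδ : 0 ≤ δ)
    (hL₁ : LocStencil₂ (fun κ u κ' u' => fun (p z : Site (d + 1)) (_ : Fib d) (b : Fib d) =>
      ∑ β : Fin (d + 1), (Z κ u κ' u' p z (Sum.inl β) b - Z κ u κ' u' (p - unitVec β) z (Sum.inl β) b)) CL₁ δ)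
    (hL₂ : LocStencil₂ (fun κ u κ' u' => fun (x p : Site (d + 1)) (a : Fib d) (_ : Fib d) =>
      ∑ β : Fin (d + 1), (Z κ u κ' u' x p a (Sum.inl β) - Z κ u κ' u' x (p - unitVec β) a (Sum.inl β))) CL₂ δ) :
    LocStencil₂ (fun κ u κ' u' => comp (trK (psiKS r n)) (comp (Z κ u κ' u') (psiKS r n)) - Z κ u κ' u')
      (faceWtSum r n * (((n : ℝ) ^ (d + 1)) * (Real.exp (δ * (((d : ℝ) + 1) * n))
          * (CL₁ * (1 + faceWtSum r n * (((d : ℝ) + 1) * ((2 * (n : ℝ) ^ (d + 1)) * Real.exp (δ * (((d : ℝ) + 1) * n))))))))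
        + faceWtSum r n * (((n : ℝ) ^ (d + 1)) * (Real.exp (δ * (((d : ℝ) + 1) * n)) * CL₂))) δ := by
  have h1 := locStencil₂_legLeft_sub_self_of_divergence_row hn hr (fun κ u κ' u' => comp (Z κ u κ' u') (psiKS r n)) hδ
    (locStencil₂_legLeftRow_compRight_of_divergence_row hn hr Z hδ hL₁)
  have h2 := locStencil₂_legRight_sub_self_of_divergence_row hn hr Z hδ hL₂
  have h := locStencil₂_add' h1 h2
  intro κ u κ' u'
  change BiLoc (comp (trK (psiKS r n)) (comp (Z κ u κ' u') (psiKS r n)) - Z κ u κ' u') u u _ δ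
  rw [(sub_add_sub_cancel (comp (trK (psiKS r n)) (comp (Z κ u κ' u') (psiKS r n))) (comp (Z κ u κ' u') (psiKS r n)) (Z κ u κ' u')).symm]
  exact h κ u κ' u'

end Summit.QuantumFields.BalabanUV.Beta.GAN24.PsiLegDefectOfDivergences

end
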